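import Mathlib
import Summits.Ventures.PercRepro2.SwOutCrossJunctionQReal
import Summits.Ventures.PercRepro2.SwOutCrossJunctionRead

/-!
# The base is read off every non-leaking point of its block (blind cell PercRepro2, night-4
g24, 2026-08-28; proofs/NIGHT4-G24.md §5)

**The reading lemma** `CrossBase.baseX_crossReal`: for a cross base `σ` and a point `q` of its
cube without red- or blue-side leak, `baseX (crossReal σ q) = σ`.  By the hull formulas of
g23 the blue side of `h` at the realisation consists of the blue u-arms, the blue far arms and —
when some u-arm is blue — `u` and the blue-attached dropped vertices; so flipping it restores the
colours of the arms, and the forcing restores the colours of the classes at `u` and at the dropped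
vertices; off the classes nothing changes.  Consequences for a cross junction: every non-leaking
point of the block of a core-kind class point lies in the outside class
(`crossReal_mem_outClass`), and the block of a core-kind class point satisfies the rigid
inequality (`card_blockX_le`, from the block theorem `rigid_block_cross` of g23).
-/

namespace Summit.Ventures.PercRepro2

namespace CrossArm

open Hull LocRows

variable {V : Type*} {E : Type*} [Fintype E] [DecidableEq E]

open scoped Classical

section Read

variable {ends : E → Sym2 V} {σ : Config E} {h u : V} {ι X κ : Type*} {U : ι → Set V}
  {p : X → V} {G : SimpleGraph X} {F : κ → Set V} (hb : CrossBase ends σ h u U p G F)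
  (hup : ∀ i, ∃ e, ends e = s(u, p i)) (hcross : ∀ i j, G.Adj i j → ∃ e, ends e = s(p i, p j))
include hb hup hcross

variable {q : PtXG ι κ X G} (hqR : ¬ LeakRX G q) (hqB : ¬ LeakBX G q)
include hqR hqB

end Read

section Junction

variable {ends : E → Sym2 V} {X : Type*} {U : Set V} {ξ : Config E} {l h o u : V} {p : X → V}
  {G : SimpleGraph X} [Fintype X] [DecidableRel G.Adj] {r : X}

variable (hj : CrossJunctionQ ends U h u p G o r) (hl : l ∉ U) {ζ : Config E}
  (hζ : ζ ∈ swOutSide ends l h o U ξ) (hk : CoreKind ends U h u ζ)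
include hj hl hζ hk

omit [Fintype X] [DecidableRel G.Adj] in
/-- Every non-leaking point of the block of a core-kind class point lies in the outside class. -/
theorem CrossJunctionQ.crossReal_mem_outClass
    {q : PtXG (ιX ends h u p (baseX ends h u p ζ)) (κX ends h u p (baseX ends h u p ζ)) X G}
    (hqR : ¬ LeakRX G q) (hqB : ¬ LeakBX G q) :
    crossReal ends u (UX ends h u p (baseX ends h u p ζ)) p G (FX ends h u p (baseX ends h u p ζ))
      (baseX ends h u p ζ) q ∈ outClass ends U h ξ := by
  have hb := hj.crossBase_of_coreKind hl hζ hk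
  have hstr := hj.strX_subset_U hl hζ hk
  rw [mem_outClass]
  refine ⟨fun e he => ?_, fun x hx => ?_⟩
  · have hnt : ∀ S : Set V, S ⊆ U → e ∉ touches ends S := fun S hS ⟨x, hx, y, hxy⟩ =>
      he ⟨x, hS hx, y, hxy⟩
    rw [CrossBase.crossReal_apply_none]
    · rw [baseX_apply_of_notMem_touches hj.hpU
        ((mem_outClass.1 (mem_swOutSide.1 hζ).2).2) he]
      exact (mem_outClass.1 (mem_swOutSide.1 hζ).2).1 e he
    · intro k hk'
      exact hnt (FX ends h u p (baseX ends h u p ζ) k)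
        (fun x hx => hstr (Or.inr (Or.inr (Or.inr (mem_armsAllX_of_F hx))))) hk'
    · intro j hj'
      exact hnt (UX ends h u p (baseX ends h u p ζ) j)
        (fun x hx => hstr (Or.inr (Or.inr (Or.inr (mem_armsAllX_of_U hx))))) hj'
    · intro i hi
      exact he ⟨u, hj.huU, p i, hi⟩
    · rintro s ⟨i, j, -, hij⟩
      exact he ⟨p i, hj.hpU i, p j, hij⟩
    · rintro i ⟨x, hx, -, -⟩
      exact he ⟨p i, hj.hpU i, x, hx⟩
  · exact hstr (hb.hull_crossReal_subset hj.hup hj.hcross hqR hqB hx)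

end Junction

end CrossArm

end Summit.Ventures.PercRepro2
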